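import Literature.IUT.HodgeTheaters.TemperedCoveringsCor23viOfSpecialFibre
import Literature.IUT.HodgeTheaters.StableCurveTemperedDataOfSpecialFibreCuspedPiDataNVExposed
import HarnessLib

/-!
# [IUTchI] Cor. 2.3 (vi) at the genuine datum: the two cusp laws `{hcusp, hhatH}` JOINTLY INHABITED, together with the
# DATA of the closer, at abc-iut-L3's CUSPED `PiData` witness (node `IUTchI:Cor2.3(vi)`, token rule (b))

S. Mochizuki, *Inter-universal Teichmüller theory I*, kurims manuscript (May 2020), §2, Cor. 2.3 (vi) p. 48
[cite: Mochizuki2012, Cor 2.3(vi) p.48] (D-0012 claim key; nothing of the series is asserted here); S. Mochizuki,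
*Semi-graphs of anabelioids*, Publ. RIMS **42** (2006), §6 p. 71 ("`I_x := D_x ∩ Δ^temp_X` is isomorphic to `Ẑ(1)`"),
Ex. 3.10 p. 44 (the special-fibre tower) [cite: MochizukiSemiAnbd2006, §6 p.71].

PROOF-ONLY non-vacuity companion (abc-iut cell, seat abc-iut-w4-d070 gen 11, row `IUTchI:Cor2.3(vi)` split (A); no
definition, no instance, no new `Prop` fact) of `TemperedCoveringsCor23viOfSpecialFibre.lean`, whose closers
`cor23vi_ofSpecialFibre_closureH_piDataTpH_of_cuspLaws` / `…_of_piData_of_cuspLaws` prove Cor. 2.3 (vi) AS TYPED at the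
genuine 𝔛-datum with print's cusp predicate from the two cusp laws `hcusp` (BASE CUSP INCIDENCE, GAP G-w4d070-g11-1)
and `hhatH` (PRO-`Σ̂` CUSP–SUBGRAPH INCIDENCE, GAP G-w4d070-g11-2).  The L5 token rule asks that DATA/LAW binders be
JOINTLY witnessed at one datum.  HERE: at abc-iut-L3's cusped free-profinite `PiData` witness WITH EXPOSED FIBRES
(`SpecialFibreTower.PiData.exists_temperedCurve_freeProfiniteTwo_cusped_exposed`, abc-iut-L5 lineage after
abc-iut-f-193 / abc-iut-L3-t2 / abc-iut-L3-t3: `Π^temp := G_{ℚ_p} × F̂₂`, ONE cusp with `I_x ≅ Ẑ`, one-vertex special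
fibres, `⊤` the unique verticial subgroup of every chart) —

* `exists_cor23vi_cuspLaws_jointly` — THERE ARE `X`, `d`, `S`, `T`, an origin record `P : PiData X d S T` and a cusp
  such that, for EVERY level `i` and EVERY `Π^tp_ℍ = TpH`, BOTH cusp laws hold: `hcusp` (the cuspidal subgroup `J_x` lies
  in a verticial subgroup at the vertex met by `ξ_x` — namely `⊤`) and `hhatH` (every cusp meets `ℍ = P.H`, which
  contains the unique vertex, its base vertex);
* `exists_cor23vi_ofSpecialFibre_piDataTpH` — hence, at that datum, the closer FIRES: Cor. 2.3 (vi) AS TYPED holds at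
  `ofSpecialFibre … P.TpH (closure ι(P.TpH)) _ (x ↦ ξ_x meets P.H)` (any prime sets with `p ∉ Σ`).

HONEST LIMITS (those of the witness, verbatim in substance): consistency evidence for OUR binders only — `Π^temp` is a
direct product and profinite (a genuine `Π^tp_X` is neither), the special fibres are one-vertex semi-graphs with no edge,
so `ℍ ⊇ {the vertex}` and "the cusp meets `ℍ`" holds for the trivial reason, and both incidences are inhabited in their
DEGENERATE one-vertex form; NOT André's `π₁^temp` of a curve; no curve is asserted to realise the datum; the laws are NOT
thereby proved at any genuine special fibre (they remain GAP rows G-w4d070-g11-1 and -2).  Nothing here bears on [IUTchIII]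
Cor. 3.12; typed ≠ inhabited ≠ discharged.
-/

noncomputable section

namespace Literature.IUT.HodgeTheaters

open scoped Pointwise
open Literature.AnabelianGeometry.SemiGraphs
open Literature.AnabelianGeometry.SemiGraphs.ProfiniteSemiGraph

namespace StableCurveTemperedData

/-- **The two cusp laws of the (vi) closer are JOINTLY INHABITED, with a cusp present, at abc-iut-L3's cusped `PiData`
witness**: for every level `i` and every `Π^tp_ℍ = TpH ≤ π₁^temp(G^c)`, `hcusp` (with `K := ⊤`, the unique verticial
subgroup of the one-vertex base fibre) and `hhatH` (its conclusion "`ξ_x` meets `ℍ`" holds for every cusp: `ℍ = P.H`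
contains the only vertex).  Consistency evidence only. [cite: MochizukiSemiAnbd2006, Ex 3.10 p.44] -/
theorem exists_cor23vi_cuspLaws_jointly (p : ℕ) [Fact p.Prime] :
    ∃ (X : TemperedCurve p) (d : X.GroupLevelData) (S : SpecialFibreData (X.toTemperedArithmeticGroup d))
      (T : SpecialFibreTower X.DeltaTemp) (P : SpecialFibreTower.PiData X d S T),
      Nonempty {x : X.Pt // X.IsCusp x} ∧ SpecialFibreTower.FiniteLevels X d S T ∧
      ∀ (i : ℕ) (h36 : S.Gc.Prop36Hypotheses) (TpH : Subgroup S.chart.G),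
        (∀ x : {x : X.Pt // X.IsCusp x},
          ∃ K ∈ verticialSubgroups S.chart ((P.proj i).vertexMap (P.vtxOfCusp i x)),
            ((X.inertia x.1).subgroupOf (X.toTemperedArithmeticGroup d).delta).map S.admissible.toMonoidHom ≤ K) ∧
        (∀ x : {x : X.Pt // X.IsCusp x},
          (∃ g : (TemperedGraphGroupData.exists_completion_of_prop36 S.Gc h36 S.chart).choose,
            (((X.inertia x.1).subgroupOf (X.toTemperedArithmeticGroup d).delta).map S.admissible.toMonoidHom).map
                (TemperedGraphGroupData.exists_completion_of_prop36 S.Gc h36 S.chart).choose_spec.choose.toMonoidHom ≤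
              MulAut.conj g • (TpH.map (TemperedGraphGroupData.exists_completion_of_prop36 S.Gc h36
                S.chart).choose_spec.choose.toMonoidHom).topologicalClosure) →
          (P.proj i).vertexMap (P.vtxOfCusp i x) ∈ P.H.verts) := by
  obtain ⟨X, d, S, T, -, -, ⟨x, hx⟩, -, -, -, -, hF, ⟨P⟩, -, ⟨-, -, -, ⟨hU⟩, -, -⟩, ⟨-, htop, -, -⟩⟩ :=
    SpecialFibreTower.PiData.exists_temperedCurve_freeProfiniteTwo_cusped_exposed p
  refine ⟨X, d, S, T, P, ⟨⟨x, hx⟩⟩, hF, fun i h36 TpH => ⟨fun y => ⟨⊤, htop _, le_top⟩, fun y _ => ?_⟩⟩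
  -- the base fibre has exactly one vertex, and `ℍ = P.H` contains the base vertex
  haveI : Unique S.Gc.graph.Vertex := hU
  rw [Subsingleton.elim ((P.proj i).vertexMap (P.vtxOfCusp i y)) P.baseVertex]
  exact P.baseVertex_mem

/-- **Hence the (vi) closer FIRES at that datum**: for any prime sets `Σ ⊆ Σ̂` with `p ∉ Σ`, Cor. 2.3 (vi) AS TYPED holds
at `ofSpecialFibre X d S h36 Σ Σ̂ … P.TpH (closure ι(P.TpH)) _ (x ↦ "ξ_x meets P.H")` for the witness's `X d S T P`
(`cor23vi_ofSpecialFibre_closureH_piDataTpH_of_cuspLaws` with both laws inhabited).  Consistency evidence only; FQ type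
per the gate rule. [cite: Mochizuki2012, Cor 2.3(vi) p.48] [claim: Mochizuki2012, status: disputed] -/
theorem exists_cor23vi_ofSpecialFibre_piDataTpH (p : ℕ) [Fact p.Prime] (Sigma SigmaHat : Set ℕ)
    (hsub : Sigma ⊆ SigmaHat) (hne : Sigma.Nonempty) (hprime : ∀ q ∈ SigmaHat, q.Prime) (hp : p ∉ Sigma) :
    ∃ (X : TemperedCurve p) (d : X.GroupLevelData) (S : SpecialFibreData (X.toTemperedArithmeticGroup d))
      (T : SpecialFibreTower X.DeltaTemp) (P : SpecialFibreTower.PiData X d S T) (h36 : S.Gc.Prop36Hypotheses),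
      Nonempty {x : X.Pt // X.IsCusp x} ∧
      ∀ i : ℕ, Literature.IUT.HodgeTheaters.StableCurveTemperedData.Cor23vi
        (ofSpecialFibre X d S h36 Sigma SigmaHat hsub hne hprime hp P.TpH ((P.TpH.map
          (TemperedGraphGroupData.exists_completion_of_prop36 S.Gc h36 S.chart).choose_spec.choose.toMonoidHom
          ).topologicalClosure) (Subgroup.le_topologicalClosure _) (fun x => (P.proj i).vertexMap (P.vtxOfCusp i x) ∈ P.H.verts)) := by
  obtain ⟨X, d, S, T, P, hx, -, hlaws⟩ := exists_cor23vi_cuspLaws_jointly p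
  refine ⟨X, d, S, T, P, S.hyp.toProp36Hypotheses, hx, fun i => ?_⟩
  obtain ⟨hcusp, hhatH⟩ := hlaws i S.hyp.toProp36Hypotheses P.TpH
  exact cor23vi_ofSpecialFibre_closureH_piDataTpH_of_cuspLaws X d S S.hyp.toProp36Hypotheses Sigma SigmaHat hsub hne
    hprime hp P i hcusp hhatH

end StableCurveTemperedData

end Literature.IUT.HodgeTheaters

end
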